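import Literature.ModelTheory.PseudofiniteFields.DefinableSetsToolkit
import HarnessLib

/-!
# Definable subsets of `K^m` with parameters: images under coordinate projections

Topic `Literature/ModelTheory/PseudofiniteFields`.  Continuation of `DefinableSetsToolkit.lean`:
the field `K` (in `Type`, with a compatible ring structure) is fixed and subsets of `K^m` are
presented EXPLICITLY as `{x : Fin m → K | φ.Realize (Sum.elim x y)}` for a ring formula `φ` with
set variables `Fin m`, parameter variables `Fin n'` and parameters `y : Fin n' → K`
([ChatzidakisVanDenDriesMacintyre1992, §2], definable sets with parameters, "by pure logic").

* `definableSet_exists_block` — for a map `f : Fin m → Fin n ⊕ Fin p` (the coordinates of `K^m`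
  split into a block of `n` kept coordinates and a block of `p` forgotten ones, repetitions
  allowed) and a definable `X ⊆ K^m`, the set `{v ∈ K^n | ∃ w ∈ K^p, (i ↦ (v, w)_{f i}) ∈ X}` is
  definable: relabel the set variable `i` to `f i` (kept coordinates stay free, forgotten ones
  become the bound block) and put the block of `p` existential quantifiers in front
  (`Formula.iExs (Fin p)`), keeping the parameters.  For `f` a bijection this is the image of `X`
  under the coordinate projection `K^m → K^n` forgetting the `Fin p` block
  (`definableSet_exists_block_equiv`, the form consumed by chart inductions).

The proof is a relabelling of variables plus Mathlib's realisation lemmas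
(`Formula.realize_iExs`, `Formula.realize_relabel`); no property of `K` beyond being a field is
used.

## References

* [ChatzidakisVanDenDriesMacintyre1992] Z. Chatzidakis, L. van den Dries, A. Macintyre, Definable
  sets over finite fields, J. reine angew. Math. 427 (1992) 107–135, §2 (definable sets with
  parameters are closed under projections).

## Not here

Images under general definable maps (graph + projection, immediate from this file and
`definableSet_inter`), quantifier elimination.
-/

namespace Literature.ModelTheory.PseudofiniteFields

open FirstOrder FirstOrder.Language FirstOrder.Ring

section DefinableProjection

variable {K : Type} [Field K] [CompatibleRing K]

/-- **Projection along a block of coordinates.**  For `f : Fin m → Fin n ⊕ Fin p` and a definable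
set `X ⊆ K^m` (ring formula with parameters `y ∈ K^{n'}`), the set
`{v ∈ K^n | ∃ w ∈ K^p, (i ↦ Sum.elim v w (f i)) ∈ X}` is definable with the same parameters: the
defining formula is `∃ w, φ(relabelled)` where the set variable `i` is sent to the free variable
`v_{f i}` or to the bound variable `w_{f i}` according to the block of `f i`. [folklore] -/
theorem definableSet_exists_block {m n p : ℕ} (f : Fin m → Fin n ⊕ Fin p) {X : Set (Fin m → K)}
    (hX : ∃ (n' : ℕ) (φ : Language.ring.Formula (Fin m ⊕ Fin n')) (y : Fin n' → K),
      X = {x | φ.Realize (Sum.elim x y)}) :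
    ∃ (n' : ℕ) (φ : Language.ring.Formula (Fin n ⊕ Fin n')) (y : Fin n' → K),
      {v : Fin n → K | ∃ w : Fin p → K, (fun i => Sum.elim v w (f i)) ∈ X} =
        {x | φ.Realize (Sum.elim x y)} := by
  obtain ⟨n', φ, y, rfl⟩ := hX
  refine ⟨n', (φ.relabel (Sum.elim
      (fun i => Sum.elim (fun k => Sum.inl (Sum.inl k)) Sum.inr (f i))
      fun j => Sum.inl (Sum.inr j)) :
        Language.ring.Formula ((Fin n ⊕ Fin n') ⊕ Fin p)).iExs (Fin p),
    y, Set.ext fun v => ?_⟩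
  have key : ∀ w : Fin p → K,
      (Sum.elim (Sum.elim v y) w ∘ Sum.elim
        (fun i => Sum.elim (fun k => Sum.inl (Sum.inl k)) Sum.inr (f i))
        fun j => Sum.inl (Sum.inr j) : Fin m ⊕ Fin n' → K) =
        Sum.elim (fun i => Sum.elim v w (f i)) y := by
    intro w
    funext x
    rcases x with i | j
    · simp only [Function.comp_apply, Sum.elim_inl]
      cases f i <;> simp
    · simp
  simp only [Set.mem_setOf_eq, Formula.realize_iExs, Formula.realize_relabel, key]

/-- **Images under coordinate projections are definable.**  For a splitting
`τ : Fin m ≃ Fin n ⊕ Fin p` of the coordinates of `K^m` into `n` kept and `p` forgotten ones and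
a definable `X ⊆ K^m`, the image `{v ∈ K^n | ∃ w ∈ K^p, τ^*(v, w) ∈ X}` of `X` under the
coordinate projection `K^m → K^n` is definable (`definableSet_exists_block` for `f = τ`).
[folklore] -/
theorem definableSet_exists_block_equiv {m n p : ℕ} (τ : Fin m ≃ Fin n ⊕ Fin p)
    (X : Set (Fin m → K))
    (hX : ∃ (n' : ℕ) (φ : Language.ring.Formula (Fin m ⊕ Fin n')) (y : Fin n' → K),
      X = {x | φ.Realize (Sum.elim x y)}) :
    ∃ (n' : ℕ) (φ : Language.ring.Formula (Fin n ⊕ Fin n')) (y : Fin n' → K),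
      {v : Fin n → K | ∃ w : Fin p → K, (fun i => Sum.elim v w (τ i)) ∈ X} =
        {x | φ.Realize (Sum.elim x y)} :=
  definableSet_exists_block τ hX

end DefinableProjection

end Literature.ModelTheory.PseudofiniteFields
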